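import Mathlib
import Summits.KontsevichZagierPeriods.Zeta5Search.Families.DualConstantTermTranslations
import Summits.KontsevichZagierPeriods.Zeta5Search.Families.DualConstantTermStar35
import HarnessLib

/-!
# ζ(5) search — Families: the dual constant term satisfies gen-1's STAR(1,6) — translation `T₀` plus two
# span inclusions

HONEST FRAMING: systematic search; no irrationality claim unless certified.  Cell `pub-zeta5`, certifier 2
(cert-2 g7, 2026-08-21).  Identities between integers; no conjecture node is used; nothing about `ζ(5)`; no number
of record moves.

Third worked instance of the plan `HOME/cert-2/g7/DEXACT-PLAN.md` §5 ("gen-1's STAR relations for the dual constant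
term = translation relations + span inclusions on the torus side").  STAR(1,6) is the translation `T₀` (marked point
`w₀`, `DualCT.coeff_transl0` of `Families/DualConstantTermTranslations`) taken at the exponent `(A+e₆+e₇, B+e₃)`,
combined with the span inclusions `L₇ = g₀ + L₀` (`DualCT.dualSpanProd_incl70`, here) and `L₆ = L₇ + g₃`
(inline; = `DualCT.dualSpanProd_incl67` of `Families/DualConstantTermStar46`); θ-certificate
`C₀ = L₆L₇/(g₀g₃)` found by the mod-p search `HOME/cert-2/g7/dexact/starcert2.py` and read off exactly
(`sol16.py`).  No hypothesis beyond the cone.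

* `DualCT.dualSpanProd_incl70` — `dualSpanProd (A+e₇) = dualSpanProd (A+e₀) + g₀·dualSpanProd A`;
* **`DualCT.coeff_star16`** —
  `(A₇ − B₀)·[g^B]N_A + (A₆+A₇+1−B₀)·[g^{B+e₃}]N_{A+e₇} − (B₀+1)·[g^{B+e₀+e₃}]N_{A+e₀+e₆} = 0` for ALL `A`, `B`;
* **`dualConstantTerm_star16`**, **`dualConstantTerm_star16'`** — the same for `CT(a)`, `CT(a−s₆)`, `CT(a−s₁)` on the
  cone, plain and in gen-1's vocabulary `κ(1,6)·CT(a) + χ₆Π₆·CT(a−s₆) − χ₁Π₁·CT(a−s₁) = 0` (common factor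
  `N+1−P₁−P₆ = B₃+1`).
-/

noncomputable section
open MvPolynomial Finset

namespace Summit.KontsevichZagierPeriods.Zeta5Search.Families.Cellular
namespace DualCT

/-- Span inclusion `{0,1,2} = {0} ∪ {1,2}`: `N_{A+e₇} = N_{A+e₀} + g₀·N_A`. -/
theorem dualSpanProd_incl70 (A : Fin 8 → ℕ) :
    dualSpanProd (Function.update A 7 (A 7 + 1)) =
      dualSpanProd (Function.update A 0 (A 0 + 1)) + X 0 * dualSpanProd A := by
  unfold dualSpanProd
  simp only [Function.update_self, Function.update_of_ne (by decide : (0 : Fin 8) ≠ 7),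
    Function.update_of_ne (by decide : (1 : Fin 8) ≠ 7), Function.update_of_ne (by decide : (2 : Fin 8) ≠ 7),
    Function.update_of_ne (by decide : (3 : Fin 8) ≠ 7), Function.update_of_ne (by decide : (6 : Fin 8) ≠ 7),
    Function.update_of_ne (by decide : (1 : Fin 8) ≠ 0), Function.update_of_ne (by decide : (2 : Fin 8) ≠ 0),
    Function.update_of_ne (by decide : (3 : Fin 8) ≠ 0), Function.update_of_ne (by decide : (6 : Fin 8) ≠ 0),
    Function.update_of_ne (by decide : (7 : Fin 8) ≠ 0), pow_succ]
  ring

/-- **STAR(1,6) for the coefficients of the dual span product** (all `A`, `B`):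
`(A₇ − B₀)·[g^B]N_A + (A₆+A₇+1−B₀)·[g^{B+e₃}]N_{A+e₇} − (B₀+1)·[g^{B+e₀+e₃}]N_{A+e₀+e₆} = 0`
— the translation `T₀` at the exponent `(A+e₆+e₇, B+e₃)` plus the span inclusions `L₇ = g₀ + L₀`, `L₆ = L₇ + g₃`
(θ-certificate `C₀ = L₆L₇/(g₀g₃)`). -/
theorem coeff_star16 (A : Fin 8 → ℕ) (B : Fin 6 →₀ ℕ) :
    ((A 7 : ℤ) - B 0) * coeff B (dualSpanProd A)
      + ((A 6 : ℤ) + A 7 + 1 - B 0) * coeff (B + Finsupp.single 3 1) (dualSpanProd (Function.update A 7 (A 7 + 1)))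
      - ((B 0 : ℤ) + 1) * coeff (B + Finsupp.single 3 1 + Finsupp.single 0 1)
          (dualSpanProd (Function.update (Function.update A 6 (A 6 + 1)) 0 (A 0 + 1))) = 0 := by
  set A' : Fin 8 → ℕ := Function.update (Function.update A 6 (A 6 + 1)) 7 (A 7 + 1) with hA'
  have T := coeff_transl0 A' (B + Finsupp.single 3 1)
  have u6 : Function.update A' 6 (A' 6 - 1) = Function.update A 7 (A 7 + 1) := by
    ext i
    by_cases h6 : i = 6
    · subst h6; simp [hA']
    · by_cases h7 : i = 7
      · subst h7; simp [hA']
      · simp [hA', h6, h7]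
  have u7 : Function.update A' 7 (A' 7 - 1) = Function.update A 6 (A 6 + 1) := by
    ext i
    by_cases h7 : i = 7
    · subst h7; simp [hA']
    · by_cases h6 : i = 6
      · subst h6; simp [hA']
      · simp [hA', h6, h7]
  have v6 : (A' 6 : ℤ) = A 6 + 1 := by simp [hA']
  have v7 : (A' 7 : ℤ) = A 7 + 1 := by simp [hA']
  have hNA' : dualSpanProd A' = dualSpanProd (Function.update (Function.update A 6 (A 6 + 1)) 0 (A 0 + 1))
      + X 0 * dualSpanProd (Function.update A 6 (A 6 + 1)) := by
    rw [hA', show Function.update (Function.update A 6 (A 6 + 1)) 7 (A 7 + 1) =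
      Function.update (Function.update A 6 (A 6 + 1)) 7 ((Function.update A 6 (A 6 + 1)) 7 + 1) by simp,
      dualSpanProd_incl70]
    simp
  have h6 : dualSpanProd (Function.update A 6 (A 6 + 1)) = dualSpanProd (Function.update A 7 (A 7 + 1))
      + X 3 * dualSpanProd A := by
    unfold dualSpanProd
    simp only [Function.update_self, Function.update_of_ne (by decide : (0 : Fin 8) ≠ 6),
      Function.update_of_ne (by decide : (1 : Fin 8) ≠ 6), Function.update_of_ne (by decide : (2 : Fin 8) ≠ 6),
      Function.update_of_ne (by decide : (3 : Fin 8) ≠ 6), Function.update_of_ne (by decide : (7 : Fin 8) ≠ 6),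
      Function.update_of_ne (by decide : (0 : Fin 8) ≠ 7), Function.update_of_ne (by decide : (1 : Fin 8) ≠ 7),
      Function.update_of_ne (by decide : (2 : Fin 8) ≠ 7), Function.update_of_ne (by decide : (3 : Fin 8) ≠ 7),
      Function.update_of_ne (by decide : (6 : Fin 8) ≠ 7), pow_succ]
    ring
  rw [u6, u7, v6, v7, hNA', coeff_add] at T
  have h0 : (0 : Fin 6) ∈ (B + Finsupp.single 3 1 + Finsupp.single 0 1).support := by simp
  have e0 : B + Finsupp.single 3 1 + Finsupp.single 0 1 - Finsupp.single 0 1 = B + Finsupp.single 3 1 :=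
    add_tsub_cancel_right _ _
  have h3 : (3 : Fin 6) ∈ (B + Finsupp.single 3 1).support := by simp
  have e3 : B + Finsupp.single 3 1 - Finsupp.single 3 1 = B := add_tsub_cancel_right _ _
  rw [coeff_X_mul', if_pos h0, e0, h6, coeff_add, coeff_X_mul', if_pos h3, e3] at T
  have cB : ((B + Finsupp.single 3 1 : Fin 6 →₀ ℕ) 0 : ℕ) = B 0 := by simp
  rw [cB] at T
  push_cast at T ⊢
  linear_combination -T

end DualCT

open DualCT
open Summit.KontsevichZagierPeriods.Zeta5Search.WedgeDictionary (slotDown starKappa fanCoeff)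
open Literature.NumberTheory.Irrationality
open Literature.NumberTheory.Irrationality.BrownZudilin2022 (bOfA)

/-- **The dual constant term satisfies gen-1's STAR(1,6)** (divided by the common factor `N+1−P₁−P₆ = B₃+1` of its
three coefficients): for `a` with `A = bzNum a ≥ 0`, `B = bzDen a ≥ 0`:
`(A₇ − B₀)·CT(a) + (A₆+A₇+1−B₀)·CT(a − s₆) − (B₀+1)·CT(a − s₁) = 0`.  UNCONDITIONAL. -/
theorem dualConstantTerm_star16 (a : Fin 8 → ℤ) (hA : ∀ i, 0 ≤ bzNum a i) (hB : ∀ i, 0 ≤ bzDen a i) :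
    (bzNum a 7 - bzDen a 0) * dualConstantTerm a
      + (bzNum a 6 + bzNum a 7 + 1 - bzDen a 0) * dualConstantTerm (a + slotDown 6)
      - (bzDen a 0 + 1) * dualConstantTerm (a + slotDown 1) = 0 := by
  set A : Fin 8 → ℕ := fun i => (bzNum a i).toNat with hAdef
  set B : Fin 6 →₀ ℕ :=
    Finsupp.equivFunOnFinite.symm fun w : Fin 6 => (bzDen a (Fin.castLE (by norm_num) w)).toNat with hBdef
  have ha0 : 0 ≤ a 0 := by simpa [bzNum] using hA 0
  have ha5 : 0 ≤ a 5 := by simpa [bzNum] using hA 5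
  have ha6 : 0 ≤ a 6 := by simpa [bzNum] using hA 7
  have hA6 : 0 ≤ a 0 + a 4 - a 2 := by simpa [bzNum] using hA 6
  have e0 : dualConstantTerm a = coeff B (dualSpanProd A) := rfl
  have e6 : dualConstantTerm (a + slotDown 6) =
      coeff (B + Finsupp.single 3 1) (dualSpanProd (Function.update A 7 (A 7 + 1))) := by
    unfold dualConstantTerm
    have hn : (fun i => (bzNum (a + slotDown 6) i).toNat) =
        Function.update (Function.update A 7 (A 7 + 1)) 5 ((bzNum a 5).toNat + 1) := by
      ext i
      fin_cases i <;> simp [hAdef, bzNum, slotDown, Function.update]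
      all_goals omega
    have hd : (Finsupp.equivFunOnFinite.symm fun w : Fin 6 =>
          (bzDen (a + slotDown 6) (Fin.castLE (by norm_num) w)).toNat) = B + Finsupp.single 3 1 := by
      ext w
      have h3' := hB 3
      fin_cases w <;>
        simp [hBdef, bzDen, slotDown, BrownZudilin2022.b24, BrownZudilin2022.b14, BrownZudilin2022.b57,
          BrownZudilin2022.b35, BrownZudilin2022.b36] at * <;> omega
    have hu : dualSpanProd (Function.update (Function.update A 7 (A 7 + 1)) 5 ((bzNum a 5).toNat + 1)) =
        dualSpanProd (Function.update A 7 (A 7 + 1)) := DualCT.dualSpanProd_update5 _ _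
    rw [hn, hd, hu]
  have e1 : dualConstantTerm (a + slotDown 1) = coeff (B + Finsupp.single 3 1 + Finsupp.single 0 1)
      (dualSpanProd (Function.update (Function.update A 6 (A 6 + 1)) 0 (A 0 + 1))) := by
    unfold dualConstantTerm
    have hn : (fun i => (bzNum (a + slotDown 1) i).toNat) =
        Function.update (Function.update A 6 (A 6 + 1)) 0 (A 0 + 1) := by
      ext i
      fin_cases i <;> simp [hAdef, bzNum, slotDown, Function.update]
      all_goals omega
    have hd : (Finsupp.equivFunOnFinite.symm fun w : Fin 6 =>
          (bzDen (a + slotDown 1) (Fin.castLE (by norm_num) w)).toNat) =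
        B + Finsupp.single 3 1 + Finsupp.single 0 1 := by
      ext w
      have h0' := hB 0; have h3' := hB 3
      fin_cases w <;>
        simp [hBdef, bzDen, slotDown, BrownZudilin2022.b24, BrownZudilin2022.b14, BrownZudilin2022.b57,
          BrownZudilin2022.b35, BrownZudilin2022.b36] at * <;> omega
    rw [hn, hd]
  have key := coeff_star16 A B
  have c6 : (bzNum a 6 : ℤ) = (A 6 : ℤ) := by simp only [hAdef]; have := hA 6; omega
  have c7 : (bzNum a 7 : ℤ) = (A 7 : ℤ) := by simp only [hAdef]; have := hA 7; omega
  have c0 : (bzDen a 0 : ℤ) = (B 0 : ℤ) := by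
    simp only [hBdef, Finsupp.coe_equivFunOnFinite_symm]; have := hB 0
    change bzDen a 0 = ((bzDen a 0).toNat : ℤ); omega
  rw [e0, e6, e1, c6, c7, c0]
  exact key

/-- The same in gen-1's STAR(1,6) vocabulary: `κ(1,6)·CT(a) + χ₆Π₆·CT(a − s₆) − χ₁Π₁·CT(a − s₁) = 0` (common
factor `N+1−P₁−P₆ = B₃+1`; two sign changes w.r.t. `DictStar` = the sign of `Q` flipping under both moves). -/
theorem dualConstantTerm_star16' (a : Fin 8 → ℤ) (hA : ∀ i, 0 ≤ bzNum a i) (hB : ∀ i, 0 ≤ bzDen a i) :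
    starKappa (bOfA a) 1 6 * dualConstantTerm a + fanCoeff (bOfA a) 6 * dualConstantTerm (a + slotDown 6)
      - fanCoeff (bOfA a) 1 * dualConstantTerm (a + slotDown 1) = 0 := by
  have h := dualConstantTerm_star16 a hA hB
  have e1 : starKappa (bOfA a) 1 6 = (bzDen a 3 + 1) * (bzNum a 7 - bzDen a 0) := by
    simp [starKappa, BrownZudilin2022.bOfA, bzNum, bzDen]; ring
  have e2 : fanCoeff (bOfA a) 6 = (bzDen a 3 + 1) * (bzNum a 6 + bzNum a 7 + 1 - bzDen a 0) := by
    simp [fanCoeff, WedgeDictionary.chiOf, WedgeDictionary.nonEdgePartners, BrownZudilin2022.bOfA, bzNum, bzDen]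
    ring
  have e3 : fanCoeff (bOfA a) 1 = (bzDen a 3 + 1) * (bzDen a 0 + 1) := by
    simp [fanCoeff, WedgeDictionary.chiOf, WedgeDictionary.nonEdgePartners, BrownZudilin2022.bOfA, bzDen]; ring
  rw [e1, e2, e3]
  linear_combination (bzDen a 3 + 1) * h

end Summit.KontsevichZagierPeriods.Zeta5Search.Families.Cellular
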